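import Summits.MatrixMultiplication.OmegaCensus.SmallFormats.MatMul22nRankGF3KernelFloor
import Summits.MatrixMultiplication.OmegaCensus.SmallFormats.MatMul227GF3Kronecker
import Summits.MatrixMultiplication.OmegaCensus.SmallFormats.MatMul2211GF3Rank37
import Summits.MatrixMultiplication.OmegaCensus.SmallFormats.MatMul226GF3Rank21
import Summits.MatrixMultiplication.OmegaCensus.SmallFormats.MatMul2210GF3Cap10Certificate
import HarnessLib

/-!
# ω-census family (a): the `𝔽₃` small-format LADDER for `⟨2,2,n⟩`, `5 ≤ n ≤ 12`, as of 2026-08-29 (one statement for the table)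

Cell `pub-omega` (unit `pub-omega-tensor`, gen 36), topic `Summits/MatrixMultiplication/OmegaCensus` (sub-folder `SmallFormats`). Framing
(verbatim): lottery ticket; floor = certified bounds/negative ranges. HONEST FRAMING: bookkeeping only — the kernel windows for
`R_𝔽₃(⟨2,2,n⟩)` collected in one theorem, sharpening `tensorRank_matMulTensor_22n_gf3_windows_5_12` (Alekseev–Nazarov floor `⌈36n/11⌉` ∨
`3n + 2`, Hopcroft–Kerr ceiling `⌈7n/2⌉`) by the kernel rungs landed since: `24 ≤ R(⟨2,2,7⟩)` (`twentyfour_le_tensorRank_227_gf3`,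
tensor g33/g34), `37 ≤ R(⟨2,2,11⟩)` (`thirtyseven_le_tensorRank_2211_gf3`, tensor g35), and this generation's `R(⟨2,2,6⟩) = 21`
(`tensorRank_226_gf3`) and `34 ≤ R(⟨2,2,10⟩)` (`thirtyfour_le_tensorRank_2210_gf3`). No new mathematics; nothing on `ω`.
-/

namespace Summit.MatrixMultiplication.OmegaCensus.SmallFormats

open Literature.Computability.AlgebraicComplexity

/-- **The `𝔽₃` ladder for `⟨2,2,n⟩`, `5 ≤ n ≤ 12` (kernel, 2026-08-29).** Exact: `n = 6` (21). Windows: `n = 5` [17,18], `7` [24,25],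
`8` [27,28], `9` [30,32], `10` [34,35], `11` [37,39], `12` [40,42]. -/
theorem tensorRank_matMulTensor_22n_gf3_ladder_5_12 :
    tensorRank (matMulTensor (ZMod 3) 2 2 5) ∈ Set.Icc 17 18 ∧
    tensorRank (matMulTensor (ZMod 3) 2 2 6) = 21 ∧
    tensorRank (matMulTensor (ZMod 3) 2 2 7) ∈ Set.Icc 24 25 ∧
    tensorRank (matMulTensor (ZMod 3) 2 2 8) ∈ Set.Icc 27 28 ∧
    tensorRank (matMulTensor (ZMod 3) 2 2 9) ∈ Set.Icc 30 32 ∧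
    tensorRank (matMulTensor (ZMod 3) 2 2 10) ∈ Set.Icc 34 35 ∧
    tensorRank (matMulTensor (ZMod 3) 2 2 11) ∈ Set.Icc 37 39 ∧
    tensorRank (matMulTensor (ZMod 3) 2 2 12) ∈ Set.Icc 40 42 := by
  obtain ⟨w5, -, w7, w8, w9, w10, w11, w12⟩ := tensorRank_matMulTensor_22n_gf3_windows_5_12
  have h6 := Enum723.tensorRank_226_gf3
  have h7 := twentyfour_le_tensorRank_227_gf3
  have h10 := Enum723.thirtyfour_le_tensorRank_2210_gf3
  have h11 := Enum723.thirtyseven_le_tensorRank_2211_gf3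
  simp only [Set.mem_Icc] at *
  omega

end Summit.MatrixMultiplication.OmegaCensus.SmallFormats
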